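import Summits.ResolutionOfSingularities.ResolutionOfSingularities.Theorems.EquisingularLiftEquisingularLiftNatSpecimenWhitneyCubicAlgebra
import Literature.AlgebraicGeometry.Resolution.MvPolynomialKillVars
import HarnessLib

/-!
# [OURS · L1 W4.5(b)] T-ISO-1 algebra layer, IV: the tangent-cone trace `Z` of the quartic is the REDUCED LINE `(ȳ₁, ȳ₂)`

Helper for the research stub `stub_elnat_tcDeltaPointResolution` (T-ISO-0⁺) of the crux `EquisingularLiftNat`
(stmt-ResolutionOfSingularities-20038; route `EquisingularLift`, chain w45b; res-L1-w45b-lead-2 CUT 08:41:07Z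
«SPECIMEN-Q DOWNSTAIRS» for res-D-pv-034: «(TC) with W := range ι, Z = the reduced LINE of the doubled tangent plane»).
NOT a statement of any manuscript; AI-written kernel lemma of the cell `res-hironaka` (weaker than expert review).

On the `x`- and `y`-charts of the point step the strict transform of `H = V(x₀²x₃² + x₁⁴ + x₂⁴)` is `V(g)`,
`g = y₂² + y₁²(1 + y₀⁴)` (`…NatSpecimenQuarticPointStep.nonempty_pointChart₀_equiv`), and the exceptional divisor is
`V(y₁)` (`y₁ =` the image of the blown-up coordinate). The (TC) centre of lead-2's rung is the REDUCED trace
`Z = (E ∩ St H)_red`; this file identifies it at ring level with the line-step centre of `…NatSpecimenQuarticLineStep`: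

* `span_X_one_g_eq` — `(y₁, g) = (y₁, y₂²)`;
* `isPrime_span_cen` — `(y₁, y₂) = (WhitneyCubic.cen)` is prime (`k[y]/(y₁,y₂) ≅ k[y₀]`);
* **`radical_span_X_one_g`** — `√(y₁, g) = (y₁, y₂) = Ideal.span (Set.range WhitneyCubic.cen)`: the reduced trace
  `Z` IS the line-step centre, so `Bl_Z(St H)` has the regular charts `isRegularRing_lineChart₀/₁` (p510354), and
  `V(Z)_red ≅ Spec k[y₀]` is regular (`Sing V(Z)_red = ∅`, the finiteness clause of (TC)).

References: folklore commutative algebra; the cited tree files.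
-/

set_option linter.dupNamespace false -- mandated namespace `Summit.<Summit>.<Problem>` of this single-conjunct summit

noncomputable section

open MvPolynomial
open Summit.ResolutionOfSingularities.ResolutionOfSingularities.Cruxes.EquisingularLiftNat.Sections

namespace Summit.ResolutionOfSingularities.ResolutionOfSingularities.Theorems.EquisingularLift.SpecimenQuartic

variable (k : Type) [Field k]

/-- `(y₁, g) = (y₁, y₂²)` for `g = y₂² + y₁²(1 + y₀⁴)`: the exceptional trace of the strict transform is the DOUBLED line.
[folklore] -/
theorem span_X_one_g_eq :
    Ideal.span {(X 1 : MvPolynomial (Fin 3) k), X 2 ^ 2 + X 1 ^ 2 * (1 + X 0 ^ 4)} =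
      Ideal.span {(X 1 : MvPolynomial (Fin 3) k), X 2 ^ 2} := by
  apply le_antisymm
  · rw [Ideal.span_le]
    rintro z hz
    simp only [Set.mem_insert_iff, Set.mem_singleton_iff] at hz
    rcases hz with rfl | rfl
    · exact Ideal.subset_span (by simp)
    · have e : (X 2 ^ 2 + X 1 ^ 2 * (1 + X 0 ^ 4) : MvPolynomial (Fin 3) k) =
          X 2 ^ 2 + X 1 * (X 1 * (1 + X 0 ^ 4)) := by ring
      rw [e]
      exact Ideal.add_mem _ (Ideal.subset_span (by simp)) (Ideal.mul_mem_right _ _ (Ideal.subset_span (by simp)))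
  · rw [Ideal.span_le]
    rintro z hz
    simp only [Set.mem_insert_iff, Set.mem_singleton_iff] at hz
    rcases hz with rfl | rfl
    · exact Ideal.subset_span (by simp)
    · have hmem : (X 2 ^ 2 + X 1 ^ 2 * (1 + X 0 ^ 4)) - X 1 * (X 1 * (1 + X 0 ^ 4)) ∈
          Ideal.span {(X 1 : MvPolynomial (Fin 3) k), X 2 ^ 2 + X 1 ^ 2 * (1 + X 0 ^ 4)} :=
        Ideal.sub_mem _ (Ideal.subset_span (by simp)) (Ideal.mul_mem_right _ _ (Ideal.subset_span (by simp)))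
      have e : (X 2 ^ 2 + X 1 ^ 2 * (1 + X 0 ^ 4)) - X 1 * (X 1 * (1 + X 0 ^ 4)) = (X 2 ^ 2 : MvPolynomial (Fin 3) k) := by
        ring
      rwa [e] at hmem

/-- `(y₁, y₂) = Ideal.span (Set.range WhitneyCubic.cen)` is a prime ideal (`k[y₀,y₁,y₂]/(y₁,y₂) ≅ k[y₀]`). [folklore] -/
theorem isPrime_span_cen : (Ideal.span (Set.range (WhitneyCubic.cen k))).IsPrime := by
  haveI := WhitneyCubic.isDomain_quotient_cen k
  exact (Ideal.Quotient.isDomain_iff_prime _).mp inferInstance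

/-- `Ideal.span (Set.range WhitneyCubic.cen) = (y₁, y₂)` as a span of two elements. [folklore] -/
theorem span_range_cen_eq_pair :
    Ideal.span (Set.range (WhitneyCubic.cen k)) = Ideal.span {(X 1 : MvPolynomial (Fin 3) k), X 2} := by
  rw [WhitneyCubic.range_cen, Set.image_pair]

/-- **The reduced exceptional trace is the line**: `√(y₁, g) = (y₁, y₂) = Ideal.span (Set.range WhitneyCubic.cen)` —
lead-2's (TC) centre `Z = (E ∩ St H)_red` for the quartic is, chartwise, the centre of the LINE STEP of
`…NatSpecimenQuarticLineStep`. [OURS · T-ISO-1 algebra] -/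
theorem radical_span_X_one_g :
    (Ideal.span {(X 1 : MvPolynomial (Fin 3) k), X 2 ^ 2 + X 1 ^ 2 * (1 + X 0 ^ 4)}).radical =
      Ideal.span (Set.range (WhitneyCubic.cen k)) := by
  rw [span_X_one_g_eq, span_range_cen_eq_pair]
  apply le_antisymm
  · -- `(y₁, y₂²) ≤ (y₁, y₂)`, which is prime hence radical
    have hprime : (Ideal.span {(X 1 : MvPolynomial (Fin 3) k), X 2}).IsPrime := by
      rw [← span_range_cen_eq_pair]; exact isPrime_span_cen k
    rw [← hprime.radical]
    apply Ideal.radical_mono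
    rw [Ideal.span_le]
    rintro z hz
    simp only [Set.mem_insert_iff, Set.mem_singleton_iff] at hz
    rcases hz with rfl | rfl
    · exact Ideal.subset_span (by simp)
    · rw [pow_two]
      exact Ideal.mul_mem_left _ _ (Ideal.subset_span (by simp))
  · rw [Ideal.span_le]
    rintro z hz
    simp only [Set.mem_insert_iff, Set.mem_singleton_iff] at hz
    rcases hz with rfl | rfl
    · exact Ideal.le_radical (Ideal.subset_span (by simp))
    · exact ⟨2, Ideal.subset_span (by simp)⟩

/-- The reduced trace has a regular (indeed polynomial) coordinate ring: `k[y]/(y₁, y₂)` is a regular ring, so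
`Sing V(Z)_red = ∅` (the finiteness clause of (TC)). [folklore] -/
theorem isRegularRing_quotient_radical_span_X_one_g :
    IsRegularRing (MvPolynomial (Fin 3) k ⧸
      (Ideal.span {(X 1 : MvPolynomial (Fin 3) k), X 2 ^ 2 + X 1 ^ 2 * (1 + X 0 ^ 4)}).radical) := by
  rw [radical_span_X_one_g]
  exact WhitneyCubic.isRegularRing_quotient_cen k

end Summit.ResolutionOfSingularities.ResolutionOfSingularities.Theorems.EquisingularLift.SpecimenQuartic

end
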